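import Summits.BirchSwinnertonDyer.BirchSwinnertonDyer.Theorems.KolyvaginDepthDoorDepthTableKuriharaDecisiveTriple32244c1p7Cert
import Summits.BirchSwinnertonDyer.BirchSwinnertonDyer.Theorems.KolyvaginDepthDoorDepthTableKuriharaAnomalous
import Summits.BirchSwinnertonDyer.BirchSwinnertonDyer.Theorems.KolyvaginDepthDoorDepthTableKuriharaAnomalous32244c1Cert
import Summits.BirchSwinnertonDyer.BirchSwinnertonDyer.Theorems.Rank2ObservatoryRank3KernelCerts007
import HarnessLib

/-!
# Route `KolyvaginDepthDoor`, crux `KolyvaginDepthSupplyKN` (stmt-BirchSwinnertonDyer-22820) —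
# DEPTH TABLE v24, RANK-THREE CURVE `32244c1` @ THE ANOMALOUS PRIME `p = 5` (`a_5 = -4 ≡ 1`): the E-side «`Ш(32244c1/ℚ)[5] = 0`»
# ONE WAY from the tree's depth-three record `cert_32244c1` @ `(5, 31·41·61)` (`δ̃ ≡ 2`), under Kim's hypothesis (iii)
# `E(ℚ_5)[5] = 0` AS PRINTED (kernel certificate) — one of g27's 26 «anomalous, outside Kim/Sakamoto» records, NOT outside Kim as printed

Helper file of the lead prover of line `levelone` (kdd-p1 g28; `--supports stmt-BirchSwinnertonDyer-22820 --as helper`);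
it closes nothing and BSD is NOT proved by it.

By v24's generic `sha_inf_torsionBy_eq_bot_of_kuriharaClaim_of_localTorsionTrivial` (`…KuriharaAnomalous`): the CLAIM of `cert_32244c1` at the
cyclic level `77531` of depth `3 ≤ rank` (kernel: `Rank3KernelCerts007.C32244c1.three_le_rank`, Rank3KernelCerts) gives
`#Sel_5(E) ≤ 5³ ≤ 5^rank` and `Ш(E)[5] = 0`, the binder `E(ℚ_5)[5] = 0` being `C32244c1.localPTorsion_5` (one `decide`). ONE WAY only
(Sakamoto's converse is printed under `p ∤ #Ẽ(𝔽_p)`); the 3×3 localisation matrix of this record was tested invertible in AGREEMENT-TEST-v23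
(python). CONDITIONAL on `hKim`, `hnf`, `hMaz` BY NAME and the record's claim; per curve; BSD is NOT proved by any of this.

References: [Kim2022StructureSelmer] Thm. 1.11 with hypothesis (iii), Prop. 3.2; [CremonaAlgorithms1997] Table 1 (32244c1); [SilvermanAEC2009] X.4.2.
-/

set_option linter.dupNamespace false

noncomputable section

open scoped Classical NumberField

namespace Summit.BirchSwinnertonDyer.BirchSwinnertonDyer.Theorems.KolyvaginDepthDoor

open Literature.NumberTheory.EllipticCurves Literature.NumberTheory.EllipticCurves.ModularForms
  WeierstrassCurve NumberField IsDedekindDomain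
open Summit.BirchSwinnertonDyer.BirchSwinnertonDyer.Theorems
open Summit.BirchSwinnertonDyer.BirchSwinnertonDyer.Rank2Observatory
open Summit.BirchSwinnertonDyer.BirchSwinnertonDyer.Rank1Residual (IntModel.frobeniusTrace_eq IntModel.integralModelInt_eq_of_map_eq)
open Summit.BirchSwinnertonDyer.Rank1Residual.Supersingular (natCard_point_eq_of_countPoints countPoints_eq_of_fast)
open Summit.BirchSwinnertonDyer.Rank1Residual.Additive (card_torsion_le_of_intModel_of_card
  isKolyvaginPrime_of_intModel_of_card isKolyvaginProduct_mul)
open Summit.BirchSwinnertonDyer.Rank1Residual.GaloisImage (hasSurjectiveModNGaloisRep_of_intModel_of_irr_of_order)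

namespace C32244c1

/-- **RANK-THREE CURVE `32244c1` @ THE ANOMALOUS PRIME `5`: a UNIT mod-`5` Kurihara number at the recorded depth-three level
`77531 = 31·41·61` (the CLAIM of `cert_32244c1`, `δ̃ ≡ 2`; hypothesis, read at level `N_E`) ⟹ `Ш(E/ℚ)[5] = 0`**, by Kim Thm. 1.11
with hypothesis (iii) `E(ℚ_5)[5] = 0` DISCHARGED by the kernel certificate `localPTorsion_5` (`a_5 = -4 ≡ 1`), `3 ≤ rank` kernel.
CONDITIONAL on `hKim`, `hnf`, `hMaz` BY NAME and the claim; per curve; BSD is not proved by it.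
[cite: Kim2022StructureSelmer, Thm. 1.11 with hypothesis (iii) (PDF p. 8), Prop. 3.2] [cite: CremonaAlgorithms1997, Table 1 (32244c1)] -/
theorem sha_inf_torsionBy_eq_bot_5_of_kuriharaClaim_77531
    (hKim : Kim2022_card_selmerGroup_le_pow_of_kuriharaNumber_ne_zero)
    (hnf : exists_isNewformOf) (hMaz : mazur_not_dvd_maninConstant_of_odd) :
    haveI := isElliptic_c32244c1; haveI := isGloballyMinimal_c32244c1;
      haveI : NeZero (((⟨0, -1, 0, -30, 81⟩ : WeierstrassCurve ℤ).map (Int.castRingHom ℚ)).conductorNorm ℤ) := neZero_conductorNorm_of_isElliptic _;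
      haveI := Fact.mk (by norm_num : Nat.Prime 5);
    (∀ (D : ModularParametrizationData ((⟨0, -1, 0, -30, 81⟩ : WeierstrassCurve ℤ).map (Int.castRingHom ℚ)) (((⟨0, -1, 0, -30, 81⟩ : WeierstrassCurve ℤ).map (Int.castRingHom ℚ)).conductorNorm ℤ)), ¬ ((5 : ℕ) : ℤ) ∣ D.maninConstant →
        (∃ u : ℚ, ‖(u : ℚ_[5])‖ = 1 ∧ ((⟨0, -1, 0, -30, 81⟩ : WeierstrassCurve ℤ).map (Int.castRingHom ℚ)).realPeriodRat = u * plusPeriod D.f) →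
        ∃ ψ : (q : ℕ) → (ZMod q)ˣ →* Multiplicative (ZMod 5),
          (∀ q ∈ (77531 : ℕ).primeFactors, Function.Surjective (ψ q)) ∧ kuriharaNumber D.f 5 77531 ψ ≠ 0) →
    (((⟨0, -1, 0, -30, 81⟩ : WeierstrassCurve ℤ).map (Int.castRingHom ℚ)).sha ⊓ AddSubgroup.torsionBy ((⟨0, -1, 0, -30, 81⟩ : WeierstrassCurve ℤ).map (Int.castRingHom ℚ)).galH1 ((5 : ℕ) : ℤ) : AddSubgroup _) = ⊥ := by
  haveI := isElliptic_c32244c1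
  haveI := isGloballyMinimal_c32244c1
  haveI iNZ : NeZero (((⟨0, -1, 0, -30, 81⟩ : WeierstrassCurve ℤ).map (Int.castRingHom ℚ)).conductorNorm ℤ) := neZero_conductorNorm_of_isElliptic _
  haveI := Fact.mk (by norm_num : Nat.Prime 5)
  haveI : NeZero (77531 : ℕ) := ⟨by norm_num⟩
  intro hδ
  have hν : (77531 : ℕ).primeFactors.card ≤ ((⟨0, -1, 0, -30, 81⟩ : WeierstrassCurve ℤ).map (Int.castRingHom ℚ)).mordellWeilRank := by
    have hc : (77531 : ℕ).primeFactors.card = 3 := by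
      rw [show (77531 : ℕ) = 31 * 41 * 61 from rfl, Nat.primeFactors_mul (by norm_num) (by norm_num),
        Nat.primeFactors_mul (by norm_num) (by norm_num),
        (show Nat.Prime 31 by norm_num).primeFactors, (show Nat.Prime 41 by norm_num).primeFactors,
        (show Nat.Prime 61 by norm_num).primeFactors]
      decide
    rw [hc]
    exact Summit.BirchSwinnertonDyer.BirchSwinnertonDyer.Rank2Observatory.Rank3KernelCerts007.C32244c1.three_le_rank
  exact sha_inf_torsionBy_eq_bot_of_kuriharaClaim_of_localTorsionTrivial hKim hnf hMaz _ 5 (by norm_num)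
    goodOrdinary_5.1 goodOrdinary_5.2 hasSurjectiveModNGaloisRep_5 localPTorsion_5 kodairaNeron_int_5 77531
    isCyclicKolyvaginLevel_5_77531 hν hδ

end C32244c1

end Summit.BirchSwinnertonDyer.BirchSwinnertonDyer.Theorems.KolyvaginDepthDoor

end
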